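import Summits.AtomisticToContinuum.HydrodynamicLimit.Theorems.CollisionIsometryCLTMacroClosureTwoScaleDefs
import HarnessLib

/-!
# Tiling average and scalar Jensen on the torus (input of `stub_blockMGF_twoScale`,
line `IdeatorTwoGen1Sketch`, crux `MacroClosure`, stmt-AtomisticToContinuum-14870)

Proof file (`--supports stmt-AtomisticToContinuum-14870`) for the registered stub `Barycentric.stub_twoScale_tiling`.

For `M > 0`, an integrable `g : 𝕋³ → ℝ` and a tilt `c`, with the `M³` translation vectors
`t κ = proj (κ/M)` (`κ : Fin 3 → Fin M`):
`ofReal (exp (c ∫ g)) ≤ ∫⁻ x, ∏_κ ofReal (exp ((c/M³) g (x + t κ)))`.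

Proof (folklore): put `F x = ∑_κ (c/M³) g (x + t κ)`; by translation invariance of the Haar probability
measure of `𝕋³`, `∫ F = M³ · (c/M³) · ∫ g = c ∫ g =: y₀`. The tangent line of `exp` at `y₀`,
`exp y₀ (1 + (F x − y₀)) ≤ exp (F x)`, integrates (probability measure) to `exp y₀ ≤ ∫⁻ ofReal (exp F)`
(scalar Jensen, valid also when `exp F` is not integrable), and `exp (F x) = ∏_κ exp ((c/M³) g (x + t κ))`.
-/

noncomputable section

open MeasureTheory Filter Set Topology InformationTheory
open scoped ENNReal ContDiff Convolution

namespace Summit.AtomisticToContinuum.HydrodynamicLimit.Theorems.MacroClosureLine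

open Literature.MathematicalPhysics.KineticTheory Literature.Analysis.FluidPDE
open Literature.Analysis.FunctionSpaces

namespace Barycentric

/-- **Tangent line of the exponential**: `exp y₀ · (1 + (y − y₀)) ≤ exp y`. [folklore] -/
private theorem exp_mul_one_add_sub_le (y₀ y : ℝ) :
    Real.exp y₀ * (1 + (y - y₀)) ≤ Real.exp y := by
  have h1 : 1 + (y - y₀) ≤ Real.exp (y - y₀) := by
    have := Real.add_one_le_exp (y - y₀)
    linarith
  calc Real.exp y₀ * (1 + (y - y₀)) ≤ Real.exp y₀ * Real.exp (y - y₀) :=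
        mul_le_mul_of_nonneg_left h1 (Real.exp_pos _).le
    _ = Real.exp y := by rw [← Real.exp_add, add_sub_cancel]

/-- **Scalar Jensen for `exp` on a probability space, `∫⁻` form**: for an integrable real `F`,
`ofReal (exp (∫ F)) ≤ ∫⁻ ofReal (exp F)` (no integrability of `exp F` needed: the right-hand side
is `∞` otherwise). Proof by integrating the tangent line of `exp` at `∫ F`. [folklore] -/
private theorem ofReal_exp_integral_le_lintegral {α : Type*} [MeasurableSpace α] {μ : Measure α}
    [IsProbabilityMeasure μ] {F : α → ℝ} (hF : Integrable F μ) :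
    ENNReal.ofReal (Real.exp (∫ x, F x ∂μ)) ≤ ∫⁻ x, ENNReal.ofReal (Real.exp (F x)) ∂μ := by
  set y₀ : ℝ := ∫ x, F x ∂μ with hy₀
  -- the tangent line `h` of `exp ∘ F` at the mean, an integrable minorant of `exp ∘ F` with integral `exp y₀`
  set h : α → ℝ := fun x => Real.exp y₀ * (1 + (F x - y₀)) with hh
  have h1F : Integrable (fun x => 1 + (F x - y₀)) μ :=
    (integrable_const 1).add (hF.sub (integrable_const y₀))
  have hFy : Integrable (fun x => F x - y₀) μ := hF.sub (integrable_const y₀)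
  have hh_int : Integrable h μ := h1F.const_mul (Real.exp y₀)
  have hh_eval : ∫ x, h x ∂μ = Real.exp y₀ := by
    simp only [hh]
    rw [integral_const_mul, integral_add (integrable_const 1) hFy,
      integral_sub hF (integrable_const y₀), integral_const, integral_const]
    simp [hy₀]
  have hhp_int : Integrable (fun x => max (h x) 0) μ := hh_int.pos_part
  calc ENNReal.ofReal (Real.exp y₀) = ENNReal.ofReal (∫ x, h x ∂μ) := by rw [hh_eval]
    _ ≤ ENNReal.ofReal (∫ x, max (h x) 0 ∂μ) :=
        ENNReal.ofReal_le_ofReal (integral_mono hh_int hhp_int fun x => le_max_left _ _)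
    _ = ∫⁻ x, ENNReal.ofReal (max (h x) 0) ∂μ :=
        ofReal_integral_eq_lintegral_ofReal hhp_int (ae_of_all _ fun x => le_max_right _ _)
    _ ≤ ∫⁻ x, ENNReal.ofReal (Real.exp (F x)) ∂μ :=
        lintegral_mono fun x => ENNReal.ofReal_le_ofReal
          (max_le (exp_mul_one_add_sub_le y₀ (F x)) (Real.exp_pos _).le)

/-- **Tiling average + scalar Jensen, general translation vectors**: for finitely many translation
vectors `t i` of `𝕋³`, an integrable `g` and weights `a`, `b` with `#ι · a = b`:
`ofReal (exp (b ∫ g)) ≤ ∫⁻ x, ∏ᵢ ofReal (exp (a · g (x + t i)))` (translation invariance of the Haar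
probability measure + scalar Jensen). [folklore] -/
private theorem ofReal_exp_le_lintegral_prod_translates {ι : Type*} [Fintype ι] (t : ι → T3)
    {g : T3 → ℝ} (hg : Integrable g) {a b : ℝ} (hab : (Fintype.card ι : ℝ) * a = b) :
    ENNReal.ofReal (Real.exp (b * ∫ x, g x)) ≤
      ∫⁻ x, ∏ i, ENNReal.ofReal (Real.exp (a * g (x + t i))) := by
  -- the tilted tiling sum `F` and its mean
  set F : T3 → ℝ := fun x => ∑ i, a * g (x + t i) with hF
  have hgt : ∀ i, Integrable (fun x => a * g (x + t i)) := fun i =>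
    (hg.comp_add_right (t i)).const_mul a
  have hF_int : Integrable F := integrable_finsetSum _ fun i _ => hgt i
  have hF_eval : ∫ x, F x = b * ∫ x, g x := by
    have h1 : ∀ i, ∫ x, a * g (x + t i) = a * ∫ x, g x := fun i => by
      rw [integral_const_mul, integral_add_right_eq_self g (t i)]
    simp only [hF, integral_finsetSum _ fun i _ => hgt i, h1, Finset.sum_const, Finset.card_univ,
      nsmul_eq_mul, ← hab]
    ring
  calc ENNReal.ofReal (Real.exp (b * ∫ x, g x)) = ENNReal.ofReal (Real.exp (∫ x, F x)) := by
        rw [hF_eval]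
    _ ≤ ∫⁻ x, ENNReal.ofReal (Real.exp (F x)) := ofReal_exp_integral_le_lintegral hF_int
    _ = ∫⁻ x, ∏ i, ENNReal.ofReal (Real.exp (a * g (x + t i))) := by
        refine lintegral_congr fun x => ?_
        simp only [hF]
        rw [Real.exp_sum, ENNReal.ofReal_prod_of_nonneg fun i _ => (Real.exp_pos _).le]

/-- **Tiling average + scalar Jensen** (registered stub `stub_twoScale_tiling`). [folklore] -/
theorem stub_twoScale_tiling : ∀ (M : ℕ), 0 < M → ∀ (g : T3 → ℝ), Integrable g → (∀ x, 0 ≤ g x) →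
    ∀ c : ℝ, 0 ≤ c → ENNReal.ofReal (Real.exp (c * ∫ x, g x)) ≤
      ∫⁻ x, ∏ κ : Fin 3 → Fin M, ENNReal.ofReal (Real.exp (c / (M : ℝ) ^ 3 * g (x + Torus.proj (Torus.cellCorner M κ)))) := by
  intro M hM g hg _ c _
  have hM' : (M : ℝ) ≠ 0 := by exact_mod_cast hM.ne'
  have hab : (Fintype.card (Fin 3 → Fin M) : ℝ) * (c / (M : ℝ) ^ 3) = c := by
    simp only [Fintype.card_fun, Fintype.card_fin]
    push_cast
    field_simp
  exact ofReal_exp_le_lintegral_prod_translates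
    (fun κ : Fin 3 → Fin M => Torus.proj (Torus.cellCorner M κ)) hg hab

end Barycentric

end Summit.AtomisticToContinuum.HydrodynamicLimit.Theorems.MacroClosureLine

end
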